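import Summits.AtomisticToContinuum.FouriersLaw.Theorems.VanishingNoiseTransferNoiseLocalityStubResponseDensityDet
import Summits.AtomisticToContinuum.FouriersLaw.Theorems.OddResponseBound.Negative.OddPairing
import Literature.MathematicalPhysics.KineticTheory.VelocityFlipNoise

/-!
# The flip-echo refutation template for C⁺ (`stub_relativeFlipEnergyBound`, line `relative-flip-energy-transfer` of crux
`NoiseLocality`, stmt-AtomisticToContinuum-11975) — negative-side support

Helper file of the line lead `prover-line-stmt-AtomisticToContinuum-11975-c1-0`.  C⁺ says: for `pinnedChain ω₂ lam β γ` (all `> 0`)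
and `T > 0` there is ONE `A` such that for EVERY length `N`, the unique deterministic weak steady family `μ0`, any `L²(μ_T)` response
density `U₀` of `δ ↦ μ0 (T+δ/2) (T−δ/2)` and the response coefficient `D₀`:  `(N−1) · ½ Σ_i ∫ (U₀ − U₀∘Θ_i)² dμ_T ≤ A · D₀²`
(`Θ_i = momentumFlip i`).  The flip Dirichlet energy on the left is not directly observable, but it is bounded BELOW by NESS linear
responses of explicit observables: for every `Θ_i`-odd test function `Y ∈ L²(μ_T)` (`Y∘Θ_i = −Y`), since `μ_T` is `Θ_i`-invariant,
`∫ Y U₀ dμ_T = ½ ∫ Y (U₀ − U₀∘Θ_i) dμ_T`, so `4 (∫ Y U₀)² ≤ (∫ Y²) · ∫ (U₀ − U₀∘Θ_i)²` (`four_mul_sq_integral_le_flip`, the sitewise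
form of `OddPairing.four_mul_sq_integral_le`); and when `Y` is smooth with compact support, `∫ Y U₀ dμ_T` IS the linear response
`d/dδ ∫ Y dμ0(T+δ/2, T−δ/2) |_{δ=0}` by the defining property of `U₀` (uniqueness of derivatives).  Hence (`flipEnergy_ge_echo`)
`½ Σ_i ∫ (U₀ − U₀∘Θ_i)² ≥ Σ_i 2 r_i² / V_i` for ANY `Θ_i`-odd smooth compactly supported `Y_i` with responses `r_i` and
`∫ Y_i² ≤ V_i` — a bound in terms of measurable NESS data only — and (`relativeFlipEnergyBound_false_of_flipEcho`) C⁺ is FALSE as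
soon as, at one parameter point and one temperature, such odd observables exhibit responses with `(N−1) Σ_i 2 r_i²/V_i` exceeding
every multiple of `D₀²` along a sequence of lengths (a FLIP-ECHO FLOOR; the deterministic-bulk causal-window mechanism of
`Cruxes/OddResponseBound/Disproof.lean` §3 predicts `≍ N²·D₀²` growth in the diffusive regime, numerics: kit j019728).
Nothing here closes an item; no new definitions.
-/

noncomputable section

open MeasureTheory Filter Topology
open scoped BigOperators

namespace Summit.AtomisticToContinuum.FouriersLaw.Theorems.NoiseLocality.FlipEcho

open Literature.MathematicalPhysics.KineticTheory.HeatConduction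
open Summit.AtomisticToContinuum.FouriersLaw.Theorems.OddResponseBound.Negative.OddPairing (four_mul_sq_integral_le)

/-- **Sitewise pairing inequality.** For any chain `P`, any `N`, `T`, site `i`, any `Θ_i`-odd `Y ∈ L²(μ_T)` and `U ∈ L²(μ_T)`
(`μ_T = P.gibbsMeasure N T`, flip-invariant): `4 (∫ Y U dμ_T)² ≤ (∫ Y² dμ_T) · ∫ (U − U∘Θ_i)² dμ_T`. [folklore] -/
theorem four_mul_sq_integral_le_flip (P : OscillatorChain) (N : ℕ) (T : ℝ) (i : Fin N)
    {Y U : PhaseSpace N → ℝ} (hodd : ∀ x, Y (momentumFlip i x) = -Y x)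
    (hY : MemLp Y 2 (P.gibbsMeasure N T)) (hU : MemLp U 2 (P.gibbsMeasure N T)) :
    4 * (∫ x, Y x * U x ∂(P.gibbsMeasure N T)) ^ 2 ≤
      (∫ x, Y x ^ 2 ∂(P.gibbsMeasure N T)) * ∫ x, (U x - U (momentumFlip i x)) ^ 2 ∂(P.gibbsMeasure N T) :=
  four_mul_sq_integral_le (P.measurePreserving_momentumFlip_gibbsMeasure N T i) (measurable_momentumFlip i)
    (momentumFlip_involutive i) hodd hY hU

/-- **Flip-echo lower bound on the flip Dirichlet energy.** For `U ∈ L²(μ_T)` and any family `Y_i` (`i : Fin N`) of `Θ_i`-odd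
`L²(μ_T)` functions with `∫ Y_i² ≤ V_i`, `0 < V_i`:  `Σ_i 2 (∫ Y_i U)² / V_i ≤ ½ Σ_i ∫ (U − U∘Θ_i)² dμ_T`. [folklore] -/
theorem flipEnergy_ge_echo (P : OscillatorChain) (N : ℕ) (T : ℝ) {U : PhaseSpace N → ℝ}
    (hU : MemLp U 2 (P.gibbsMeasure N T)) (Y : Fin N → PhaseSpace N → ℝ) (V : Fin N → ℝ)
    (hodd : ∀ i x, Y i (momentumFlip i x) = -Y i x) (hY : ∀ i, MemLp (Y i) 2 (P.gibbsMeasure N T))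
    (hV : ∀ i, 0 < V i) (hYV : ∀ i, ∫ x, Y i x ^ 2 ∂(P.gibbsMeasure N T) ≤ V i) :
    ∑ i : Fin N, 2 * (∫ x, Y i x * U x ∂(P.gibbsMeasure N T)) ^ 2 / V i ≤
      (1 / 2) * ∑ i : Fin N, ∫ x, (U x - U (momentumFlip i x)) ^ 2 ∂(P.gibbsMeasure N T) := by
  rw [Finset.mul_sum]
  refine Finset.sum_le_sum fun i _ => ?_
  have h1 := four_mul_sq_integral_le_flip P N T i (hodd i) (hY i) hU
  set I : ℝ := ∫ x, (U x - U (momentumFlip i x)) ^ 2 ∂(P.gibbsMeasure N T) with hI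
  set B : ℝ := ∫ x, Y i x * U x ∂(P.gibbsMeasure N T) with hB
  set W : ℝ := ∫ x, Y i x ^ 2 ∂(P.gibbsMeasure N T) with hW
  have h0 : 0 ≤ I := integral_nonneg fun x => sq_nonneg _
  rw [div_le_iff₀ (hV i)]
  calc 2 * B ^ 2 = (1 / 2) * (4 * B ^ 2) := by ring
    _ ≤ (1 / 2) * (W * I) := mul_le_mul_of_nonneg_left h1 (by norm_num)
    _ ≤ (1 / 2) * (V i * I) := mul_le_mul_of_nonneg_left (mul_le_mul_of_nonneg_right (hYV i) h0) (by norm_num)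
    _ = (1 / 2) * I * V i := by ring

/-- **The linear response of a smooth compactly supported observable is its pairing with ANY response density** (uniqueness of the
derivative at `δ = 0`). [folklore] -/
theorem response_eq_integral_mul {N : ℕ} (P : OscillatorChain) (T : ℝ) (μ0 : ℝ → ℝ → Measure (PhaseSpace N))
    {U : PhaseSpace N → ℝ}
    (hU : ∀ g : PhaseSpace N → ℝ, ContDiff ℝ ((⊤ : ℕ∞) : WithTop ℕ∞) g → HasCompactSupport g →
      HasDerivAt (fun δ : ℝ => ∫ x, g x ∂(μ0 (T + δ / 2) (T - δ / 2))) (∫ x, g x * U x ∂(P.gibbsMeasure N T)) 0)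
    {Y : PhaseSpace N → ℝ} (hYs : ContDiff ℝ ((⊤ : ℕ∞) : WithTop ℕ∞) Y) (hYc : HasCompactSupport Y) {r : ℝ}
    (hr : HasDerivAt (fun δ : ℝ => ∫ x, Y x ∂(μ0 (T + δ / 2) (T - δ / 2))) r 0) :
    r = ∫ x, Y x * U x ∂(P.gibbsMeasure N T) :=
  hr.unique (hU Y hYs hYc)

/-- **C⁺ is false under a flip-echo floor** (refutation template for the registered stub `stub_relativeFlipEnergyBound` of line
`relative-flip-energy-transfer`; the stub text is the consequent, negated).  HYPOTHESIS (flip-echo floor, all data explicit): at some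
parameter point (all `> 0`) and temperature `T > 0`, for every `A` there are a length `N ≥ 2`, the unique deterministic weak steady
family `μ0` with a response coefficient `D0` at `T`, and `Θ_i`-odd smooth compactly supported observables `Y_i ∈ L²(μ_T)` with
linear responses `r_i = d/dδ ∫ Y_i dμ0(T+δ/2,T−δ/2)|₀` and second moments `∫ Y_i² ≤ V_i` (`V_i > 0`) such that
`A · D0² < (N−1) · Σ_i 2 r_i² / V_i`.  CONCLUSION: the relative flip-energy bound fails.  Proof: a response density `U₀` exists
(landed `Theorems.NoiseLocality.stub_responseDensityDet`), `r_i = ∫ Y_i U₀` (`response_eq_integral_mul`), `flipEnergy_ge_echo`. [folklore] -/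
theorem relativeFlipEnergyBound_false_of_flipEcho
    (hecho : ∃ ω₂ lam β γ : ℝ, 0 < ω₂ ∧ 0 < lam ∧ 0 < β ∧ 0 < γ ∧ ∃ T : ℝ, 0 < T ∧ ∀ A : ℝ,
      ∃ (N : ℕ) (_ : 2 ≤ N) (μ0 : ℝ → ℝ → MeasureTheory.Measure (Literature.MathematicalPhysics.KineticTheory.HeatConduction.PhaseSpace N))
        (_ : ∀ T_L T_R : ℝ, 0 < T_L → 0 < T_R → (Literature.MathematicalPhysics.KineticTheory.HeatConduction.pinnedChain ω₂ lam β γ).IsSteadyState N T_L T_R (μ0 T_L T_R) ∧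
          ∀ ν : MeasureTheory.Measure (Literature.MathematicalPhysics.KineticTheory.HeatConduction.PhaseSpace N), (Literature.MathematicalPhysics.KineticTheory.HeatConduction.pinnedChain ω₂ lam β γ).IsSteadyState N T_L T_R ν → ν = μ0 T_L T_R)
        (D0 : ℝ) (_ : Filter.Tendsto (fun δ : ℝ => (Literature.MathematicalPhysics.KineticTheory.HeatConduction.pinnedChain ω₂ lam β γ).totalCurrent (μ0 (T + δ / 2) (T - δ / 2)) / δ)
          (nhdsWithin 0 {(0 : ℝ)}ᶜ) (nhds D0))
        (Y : Fin N → Literature.MathematicalPhysics.KineticTheory.HeatConduction.PhaseSpace N → ℝ) (r V : Fin N → ℝ),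
        (∀ i x, Y i (Literature.MathematicalPhysics.KineticTheory.HeatConduction.momentumFlip i x) = -Y i x) ∧
        (∀ i, MeasureTheory.MemLp (Y i) 2 ((Literature.MathematicalPhysics.KineticTheory.HeatConduction.pinnedChain ω₂ lam β γ).gibbsMeasure N T)) ∧
        (∀ i, ContDiff ℝ ((⊤ : ℕ∞) : WithTop ℕ∞) (Y i) ∧ HasCompactSupport (Y i)) ∧
        (∀ i, HasDerivAt (fun δ : ℝ => ∫ x, Y i x ∂(μ0 (T + δ / 2) (T - δ / 2))) (r i) 0) ∧
        (∀ i, 0 < V i ∧ ∫ x, Y i x ^ 2 ∂((Literature.MathematicalPhysics.KineticTheory.HeatConduction.pinnedChain ω₂ lam β γ).gibbsMeasure N T) ≤ V i) ∧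
        A * D0 ^ 2 < ((N : ℝ) - 1) * ∑ i : Fin N, 2 * r i ^ 2 / V i) :
    ¬ (∀ ω₂ lam β γ : ℝ, 0 < ω₂ → 0 < lam → 0 < β → 0 < γ → ∀ T : ℝ, 0 < T → ∃ A : ℝ, ∀ (N : ℕ)
    (μ0 : ℝ → ℝ → MeasureTheory.Measure (Literature.MathematicalPhysics.KineticTheory.HeatConduction.PhaseSpace N)),
    (∀ T_L T_R : ℝ, 0 < T_L → 0 < T_R →
      (Literature.MathematicalPhysics.KineticTheory.HeatConduction.pinnedChain ω₂ lam β γ).IsSteadyState N T_L T_R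
          (μ0 T_L T_R) ∧
        ∀ ν : MeasureTheory.Measure (Literature.MathematicalPhysics.KineticTheory.HeatConduction.PhaseSpace N),
          (Literature.MathematicalPhysics.KineticTheory.HeatConduction.pinnedChain ω₂ lam β γ).IsSteadyState N T_L T_R ν →
            ν = μ0 T_L T_R) →
    ∀ U0 : Literature.MathematicalPhysics.KineticTheory.HeatConduction.PhaseSpace N → ℝ,
    (MeasureTheory.MemLp U0 2
          ((Literature.MathematicalPhysics.KineticTheory.HeatConduction.pinnedChain ω₂ lam β γ).gibbsMeasure N T) ∧
        (∀ g : Literature.MathematicalPhysics.KineticTheory.HeatConduction.PhaseSpace N → ℝ,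
          ContDiff ℝ ((⊤ : ℕ∞) : WithTop ℕ∞) g → HasCompactSupport g →
            HasDerivAt (fun δ : ℝ => ∫ x, g x ∂(μ0 (T + δ / 2) (T - δ / 2)))
              (∫ x, g x * U0 x
                ∂((Literature.MathematicalPhysics.KineticTheory.HeatConduction.pinnedChain ω₂ lam β γ).gibbsMeasure N T))
              0) ∧
        HasDerivAt (fun δ : ℝ =>
            (Literature.MathematicalPhysics.KineticTheory.HeatConduction.pinnedChain ω₂ lam β γ).totalCurrent
              (μ0 (T + δ / 2) (T - δ / 2)))
          (∑ i : Fin N, ∫ x,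
            (Literature.MathematicalPhysics.KineticTheory.HeatConduction.pinnedChain ω₂ lam β γ).bondCurrent N i x * U0 x
              ∂((Literature.MathematicalPhysics.KineticTheory.HeatConduction.pinnedChain ω₂ lam β γ).gibbsMeasure N T))
          0) →
    ∀ D0 : ℝ,
    Filter.Tendsto (fun δ : ℝ =>
        (Literature.MathematicalPhysics.KineticTheory.HeatConduction.pinnedChain ω₂ lam β γ).totalCurrent
          (μ0 (T + δ / 2) (T - δ / 2)) / δ) (nhdsWithin 0 {(0 : ℝ)}ᶜ) (nhds D0) →
    ((N : ℝ) - 1) *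
        ((1 / 2) * ∑ i : Fin N, ∫ x,
          (U0 x - U0 (Literature.MathematicalPhysics.KineticTheory.HeatConduction.momentumFlip i x)) ^ 2
            ∂((Literature.MathematicalPhysics.KineticTheory.HeatConduction.pinnedChain ω₂ lam β γ).gibbsMeasure N T)) ≤
      A * D0 ^ 2) := by
  intro hC
  obtain ⟨ω₂, lam, β, γ, hω, hl, hβ, hγ, T, hT, hA⟩ := hecho
  obtain ⟨A, hAN⟩ := hC ω₂ lam β γ hω hl hβ hγ T hT
  obtain ⟨N, hN, μ0, hμ0, D0, hD0, Y, r, V, hodd, hY, hYs, hr, hV, hlt⟩ := hA A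
  set P := pinnedChain ω₂ lam β γ with hP
  obtain ⟨U0, hU0⟩ := Summit.AtomisticToContinuum.FouriersLaw.Theorems.NoiseLocality.stub_responseDensityDet
    ω₂ lam β γ hω hl hβ hγ T hT N μ0 hμ0
  have hbound := hAN N μ0 hμ0 U0 hU0 D0 hD0
  -- identify the responses with pairings against `U0`
  have hri : ∀ i, r i = ∫ x, Y i x * U0 x ∂(P.gibbsMeasure N T) := fun i =>
    response_eq_integral_mul P T μ0 hU0.2.1 (hYs i).1 (hYs i).2 (hr i)
  have hecho' := flipEnergy_ge_echo P N T hU0.1 Y V hodd hY (fun i => (hV i).1) (fun i => (hV i).2)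
  have hn : 0 ≤ (N : ℝ) - 1 := by
    have : (2 : ℝ) ≤ N := by exact_mod_cast hN
    linarith
  have hsum : ∑ i : Fin N, 2 * r i ^ 2 / V i = ∑ i : Fin N, 2 * (∫ x, Y i x * U0 x ∂(P.gibbsMeasure N T)) ^ 2 / V i :=
    Finset.sum_congr rfl fun i _ => by rw [hri i]
  have hchain : ((N : ℝ) - 1) * ∑ i : Fin N, 2 * r i ^ 2 / V i ≤ A * D0 ^ 2 := by
    rw [hsum]
    exact (mul_le_mul_of_nonneg_left hecho' hn).trans hbound
  linarith

/-- Registered helper sub-goal `helper_relativeFlipEnergyBoundFalseOfFlipEcho` of crux stmt-AtomisticToContinuum-11975 =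
`relativeFlipEnergyBound_false_of_flipEcho` in registry form: a flip-echo floor refutes the stub text of `stub_relativeFlipEnergyBound`
(negative-side template; nothing is closed). [folklore] -/
theorem helper_relativeFlipEnergyBoundFalseOfFlipEcho : (∃ ω₂ lam β γ : ℝ, 0 < ω₂ ∧ 0 < lam ∧ 0 < β ∧ 0 < γ ∧ ∃ T : ℝ, 0 < T ∧ ∀ A : ℝ, ∃ (N : ℕ) (_ : 2 ≤ N) (μ0 : ℝ → ℝ → MeasureTheory.Measure (Literature.MathematicalPhysics.KineticTheory.HeatConduction.PhaseSpace N)) (_ : ∀ T_L T_R : ℝ, 0 < T_L → 0 < T_R → (Literature.MathematicalPhysics.KineticTheory.HeatConduction.pinnedChain ω₂ lam β γ).IsSteadyState N T_L T_R (μ0 T_L T_R) ∧ ∀ ν : MeasureTheory.Measure (Literature.MathematicalPhysics.KineticTheory.HeatConduction.PhaseSpace N), (Literature.MathematicalPhysics.KineticTheory.HeatConduction.pinnedChain ω₂ lam β γ).IsSteadyState N T_L T_R ν → ν = μ0 T_L T_R) (D0 : ℝ) (_ : Filter.Tendsto (fun δ : ℝ => (Literature.MathematicalPhysics.KineticTheory.HeatConduction.pinnedChain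 ω₂ lam β γ).totalCurrent (μ0 (T + δ / 2) (T - δ / 2)) / δ) (nhdsWithin 0 {(0 : ℝ)}ᶜ) (nhds D0)) (Y : Fin N → Literature.MathematicalPhysics.KineticTheory.HeatConduction.PhaseSpace N → ℝ) (r V : Fin N → ℝ), (∀ i x, Y i (Literature.MathematicalPhysics.KineticTheory.HeatConduction.momentumFlip i x) = -Y i x) ∧ (∀ i, MeasureTheory.MemLp (Y i) 2 ((Literature.MathematicalPhysics.KineticTheory.HeatConduction.pinnedChain ω₂ lam β γ).gibbsMeasure N T)) ∧ (∀ i, ContDiff ℝ ((⊤ : ℕ∞) : WithTop ℕ∞) (Y i) ∧ HasCompactSupport (Y i)) ∧ (∀ i, HasDerivAt (fun δ : ℝ => ∫ x, Y i x ∂(μ0 (T + δ / 2) (T - δ / 2))) (r i) 0) ∧ (∀ i, 0 < V i ∧ ∫ x, Y i x ^ 2 ∂((Literature.MathematicalPhysics.KineticTheory.HeatConduction.pinnedChain ω₂ lam β γ).gibbsMeasure N T) ≤ V i) ∧ A * D0 ^ 2 < ((N : ℝ) - 1) * ∑ i : Fin N, 2 * r i ^ 2 / V i) → ¬ (∀ ω₂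 lam β γ : ℝ, 0 < ω₂ → 0 < lam → 0 < β → 0 < γ → ∀ T : ℝ, 0 < T → ∃ A : ℝ, ∀ (N : ℕ) (μ0 : ℝ → ℝ → MeasureTheory.Measure (Literature.MathematicalPhysics.KineticTheory.HeatConduction.PhaseSpace N)), (∀ T_L T_R : ℝ, 0 < T_L → 0 < T_R → (Literature.MathematicalPhysics.KineticTheory.HeatConduction.pinnedChain ω₂ lam β γ).IsSteadyState N T_L T_R (μ0 T_L T_R) ∧ ∀ ν : MeasureTheory.Measure (Literature.MathematicalPhysics.KineticTheory.HeatConduction.PhaseSpace N), (Literature.MathematicalPhysics.KineticTheory.HeatConduction.pinnedChain ω₂ lam β γ).IsSteadyState N T_L T_R ν → ν = μ0 T_L T_R) → ∀ U0 : Literature.MathematicalPhysics.KineticTheory.HeatConduction.PhaseSpace N → ℝ, (MeasureTheory.MemLp U0 2 ((Literature.MathematicalPhysics.KineticTheory.HeatConduction.pinnedChain ω₂ lam β γ).gibbsMeasure N T) ∧ (∀ g : Literature.MathematicalPhysics.KineticTheory.HeatConduction.PhaseSpace N → ℝ, ContDiff ℝ ((⊤ : ℕ∞) : WithTop ℕ∞)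 g → HasCompactSupport g → HasDerivAt (fun δ : ℝ => ∫ x, g x ∂(μ0 (T + δ / 2) (T - δ / 2))) (∫ x, g x * U0 x ∂((Literature.MathematicalPhysics.KineticTheory.HeatConduction.pinnedChain ω₂ lam β γ).gibbsMeasure N T)) 0) ∧ HasDerivAt (fun δ : ℝ => (Literature.MathematicalPhysics.KineticTheory.HeatConduction.pinnedChain ω₂ lam β γ).totalCurrent (μ0 (T + δ / 2) (T - δ / 2))) (∑ i : Fin N, ∫ x, (Literature.MathematicalPhysics.KineticTheory.HeatConduction.pinnedChain ω₂ lam β γ).bondCurrent N i x * U0 x ∂((Literature.MathematicalPhysics.KineticTheory.HeatConduction.pinnedChain ω₂ lam β γ).gibbsMeasure N T)) 0) → ∀ D0 : ℝ, Filter.Tendsto (fun δ : ℝ => (Literature.MathematicalPhysics.KineticTheory.HeatConduction.pinnedChain ω₂ lam β γ).totalCurrent (μ0 (T + δ / 2) (T - δ / 2)) / δ) (nhdsWithin 0 {(0 : ℝ)}ᶜ) (nhds D0) → ((N : ℝ) - 1) * ((1 / 2) * ∑ i : Fin N, ∫ x, (U0 x - U0 (Literature.MathematicalPhysics.KineticTheory.HeatConduction.momentumFlip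 i x)) ^ 2 ∂((Literature.MathematicalPhysics.KineticTheory.HeatConduction.pinnedChain ω₂ lam β γ).gibbsMeasure N T)) ≤ A * D0 ^ 2) :=
  fun h => relativeFlipEnergyBound_false_of_flipEcho h

end Summit.AtomisticToContinuum.FouriersLaw.Theorems.NoiseLocality.FlipEcho

end
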